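import Literature.AlgebraicTopology.FundamentalGroup.QuotientCoveringConjugation
import Literature.AlgebraicTopology.FundamentalGroup.MonodromyNaturality
import Literature.AlgebraicTopology.FundamentalGroup.MapOfEqRange
import Literature.Barriers.HodgeConjecture.ConjugateVarietiesSerreProofs
import Mathlib.Topology.Algebra.Module.FiniteDimension
import Mathlib.Analysis.Normed.Module.FiniteDimension
import HarnessLib

/-!
# Serre 1964 for the topological models: `(Y × A)/G` and `(Y × A')/G` are not homeomorphic (proved)

Companion to `ConjugateVarieties.lean` (barrier fact `Serre1964_conjugateVarieties_notHomeomorphic`),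
`ConjugateVarietiesSerreProofs.lean` (the ALGEBRAIC half of Serre's proof:
`Serre1964.isEmpty_mulEquiv_numberField`) and `ConjugateVarietiesSerreAssemblyProofs.lean`.
Proofs only; no definitions, no named facts.

J.-P. Serre, *Exemples de variétés projectives conjuguées non homéomorphes*, C. R. Acad. Sci.
Paris 258 (1964) 4194–4196 (= *Œuvres* II no. 63), no. 2 (p. 4195), verbatim: "Nous prendrons
comme variété `V` le quotient de `Y × A` par `G`, le groupe `G` opérant sur `Y × A` par la formule
`g(y, a) = (g⁻¹y, ga)`. On obtient ainsi une variété projective non singulière, qui est un espace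
fibré isotrivial, de base `X` et de fibre `A`. Comme cet espace fibré admet une section, le
groupe `π₁(V_φ)` s'identifie au produit semi-direct de `G` par `π₁(A_φ)`, les opérations de `G`
sur `π₁(A_φ)` étant celles déduites de la structure de `S`-module de `π₁(A_φ)`; on a un résultat
analogue pour `π₁(V_ψ)`."  Here `Y` is simply connected ("sur le corps `ℂ`, c'est un espace
simplement connexe, en vertu d'un théorème de Lefschetz"), `G = ℤ/p` acts freely on `Y` and
through `S = ℤ[ζ_p] ⊆ End(A)` on the abelian variety `A`, and `π₁(A_φ) ≅ S`,
`π₁(A_ψ) ≅ e_ψ S` (Lemme 2).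

This file proves the TOPOLOGICAL content of this paragraph together with the Théorème, for
arbitrary topological models of the two quotients:

* `isEmpty_mulEquiv_fundamentalGroup_of_quotientCovering` — let `q₁ : E₁ → X₁ = E₁/G₁` and
  `q₂ : E₂ → X₂ = E₂/G₂` be quotient covering maps (Mathlib `IsQuotientCoveringMap`: free,
  evenly-covering actions) of groups of order `p` on path-connected spaces, with
  `π₁(E₁, e₁) ≅ (𝓞 ℚ(ζ_p), +)` and `π₁(E₂, e₂) ≅ (𝔟 𝓞 ℚ(ζ_p), +)` (`𝔟 ⊂ 𝓞 k` non-principal,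
  `([ℚ(ζ_p) : k], h_k) = 1`) in such a way that the deck transformation `g⁻¹`, transported back
  to the base point along a path `δ : e ⟶ g • e` (`twistedTransport`, i.e. the conjugation action
  of the loop `q ∘ δ` of the base, `map_twistedTransport_eq_conj`), acts as multiplication by
  `ζ_p`.  Then `π₁(X₁, q₁ e₁) ≄ π₁(X₂, q₂ e₂)`: the images `q_* π₁(Eᵢ)` are normal of index `p`
  (`QuotientCovering.normal_range_mapOfEq`, `QuotientCovering.index_range_mapOfEq`), copies of
  `𝓞` resp. `𝔟𝓞` on which `[q ∘ δ]` acts as `ζ_p`, so the algebraic Théorème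
  `isEmpty_mulEquiv_numberField` applies.
* `isEmpty_homeomorph_of_quotientCovering` — hence `X₁`, `X₂` are not homeomorphic (`X₂` is path
  connected, so `π₁` does not depend on the base point).
* `isEmpty_homeomorph_of_quotientCovering_prod` — **Serre's shape**: `Eᵢ = Yᵢ × Aᵢ` with `Yᵢ`
  simply connected, `Aᵢ` path connected with abelian `π₁(Aᵢ, aᵢ)`, `G` acting diagonally, fixing
  `aᵢ ∈ Aᵢ` ("`ga`", a group automorphism of the abelian variety), and the induced automorphism
  `(g⁻¹)_*` of `π₁(A₁, a₁) ≅ 𝓞`, resp. `π₁(A₂, a₂) ≅ 𝔟𝓞`, being multiplication by `ζ_p` ("les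
  opérations de `G` sur `π₁(A_φ)` étant celles déduites de la structure de `S`-module"): then
  `(Y₁ × A₁)/G ≄ₜ (Y₂ × A₂)/G`.  (The transfer from `A` to `Y × A` uses
  `bijective_map_snd_of_simplyConnectedSpace` and the naturality of twisted transport.)
* `isEmpty_homeomorph_of_torusModels` — **Serre's models**: moreover `Aᵢ = Vᵢ/Λᵢ` tori (`Vᵢ`
  simply connected commutative topological groups, `Λᵢ` discrete subgroups, `Λ₁ ≅ 𝓞`,
  `Λ₂ ≅ 𝔟𝓞` additively) with `gᵢ⁻¹` acting as the torus map of an additive continuous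
  `Mᵢ : Vᵢ → Vᵢ` restricting to multiplication by `ζ_p` on the lattice ("`S` opère sur `A`");
  then ALL hypotheses on `A` (abelian `π₁`, fixed point, `(g⁻¹)_* = ζ_p` on `π₁(A, 0) ≅ Λ`) are
  discharged by covering theory (`MonodromyNaturality.lean`:
  `exists_mulEquiv_fundamentalGroup_torus`), leaving as hypotheses only the quotient-covering
  property of the diagonal action and the simple connectivity of `Y`.
* `isEmpty_homeomorph_orbitSpace_of_torusModels` — the same for the ORBIT SPACES
  `(Yᵢ × Vᵢ/Λᵢ)/Gᵢ` of free continuous actions of finite groups of order `p` on locally compact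
  Hausdorff spaces (the quotient covering property being Mathlib's
  `isQuotientCoveringMap_quotientMk_of_properlyDiscontinuousSMul`): the literal shape of
  "`V` le quotient de `Y × A` par `G`" on complex points.
* `isEmpty_homeomorph_orbitSpace_of_latticeModels` — the same with `Vᵢ` finite-dimensional real
  normed spaces, `Λᵢ` discrete additive subgroups (`ℤ`-submodules with the discrete topology,
  e.g. full lattices `π₁(A_φ) ⊂ ℂ^g`) and `Mᵢ` real-linear: simple connectivity and local
  compactness of `Vᵢ`, discreteness, and the Hausdorff / locally compact quotient are then
  automatic (Mathlib instances), as is the continuity of `Mᵢ`.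

What remains between this and `Serre1964_conjugateVarieties_notHomeomorphic_holds` is purely
algebro-geometric and analytic (recorded in `ConjugateVarietiesSerreAssemblyProofs.lean`):
Serre's `V` over the Hilbert class field with `V_φ(ℂ) ≃ₜ (Y(ℂ) × A_φ(ℂ))/G` for the strong
topology, `Y(ℂ)` simply connected (Lefschetz), and `π₁(A_φ(ℂ), 0) ≅ e_φ ⊗ S` equivariantly
(uniformisation and complex multiplication).

## References

* [Serre1964Conjugate] J.-P. Serre, C. R. Acad. Sci. Paris 258 (1964) 4194–4196, no. 2 and
  Théorème p. 4196.
* [HatcherAT2002] A. Hatcher, *Algebraic Topology*, Props. 1.12, 1.31, 1.39, 1.40.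
-/

noncomputable section

namespace Literature.Barriers.HodgeConjecture.Serre1964

open NumberField Multiplicative Literature.AlgebraicTopology.FundamentalGroup

/-- **Serre 1964, Théorème, for topological models of `V_φ`, `V_ψ`.** Let `qᵢ : Eᵢ → Xᵢ`
(`i = 1, 2`) be quotient covering maps by groups `Gᵢ` of prime order `p` of path-connected spaces,
`eᵢ ∈ Eᵢ`, `gᵢ ∈ Gᵢ`, `δᵢ` a path from `eᵢ` to `gᵢ • eᵢ`, and suppose `π₁(E₁, e₁) ≅ (𝓞 K₀, +)`,
`π₁(E₂, e₂) ≅ (𝔟 𝓞 K₀, +)` (`K₀ = ℚ(ζ_p)`, `k ⊆ K₀`, `𝔟 ⊂ 𝓞 k` non-principal,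
`([K₀ : k], h_k) = 1`) so that the twisted transport `β ↦ gᵢ⁻¹ ∘ (δᵢ⁻¹ β δᵢ)` is multiplication
by `ζ_p`.  Then `π₁(X₁, q₁ e₁)` and `π₁(X₂, q₂ e₂)` are not isomorphic: `qᵢ_* π₁(Eᵢ)` is normal of
index `p` (`QuotientCovering.normal_range_mapOfEq`, `index_range_mapOfEq`), injectively `𝓞`
resp. `𝔟𝓞` (`mapOfEq_injective_of_isCoveringMap`), and `[qᵢ ∘ δᵢ]` acts on it as `ζ_p`
(`map_twistedTransport_eq_conj`) — the hypotheses of the algebraic Théorème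
`isEmpty_mulEquiv_numberField` ("`π₁(V_φ) = π₁(A_φ) ⋊ G`", Serre no. 2, with Lemme 2 and the
Théorème p. 4196). [cite: Serre1964Conjugate, no. 2 and Théorème p. 4196] -/
theorem isEmpty_mulEquiv_fundamentalGroup_of_quotientCovering
    {p : ℕ} [Fact p.Prime] {K₀ : Type*} [Field K₀] [NumberField K₀]
    [IsCyclotomicExtension {p} ℚ K₀] {ζ : K₀} (hζ : IsPrimitiveRoot ζ p)
    {k : Type*} [Field k] [NumberField k] [Algebra k K₀]
    {𝔟 : Ideal (𝓞 k)} (h𝔟0 : 𝔟 ≠ ⊥) (h𝔟 : ¬ 𝔟.IsPrincipal)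
    (hcop : Nat.Coprime (Module.finrank k K₀) (Fintype.card (ClassGroup (𝓞 k))))
    {E₁ X₁ G₁ : Type*} [TopologicalSpace E₁] [TopologicalSpace X₁] [Group G₁] [MulAction G₁ E₁]
    [ContinuousConstSMul G₁ E₁] [PathConnectedSpace E₁] {q₁ : E₁ → X₁} (hq₁ : IsQuotientCoveringMap q₁ G₁)
    (hG₁ : Nat.card G₁ = p) (e₁ : E₁) (g₁ : G₁) (δ₁ : Path e₁ (g₁ • e₁))
    (j₁ : Multiplicative (𝓞 K₀) ≃* FundamentalGroup E₁ e₁)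
    (hj₁ : ∀ s : 𝓞 K₀, twistedTransport ⟨fun z ↦ g₁⁻¹ • z, continuous_const_smul _⟩ δ₁
      (inv_smul_smul g₁ e₁) (j₁ (ofAdd s)) = j₁ (ofAdd (hζ.toInteger * s)))
    {E₂ X₂ G₂ : Type*} [TopologicalSpace E₂] [TopologicalSpace X₂] [Group G₂] [MulAction G₂ E₂]
    [ContinuousConstSMul G₂ E₂] [PathConnectedSpace E₂] {q₂ : E₂ → X₂} (hq₂ : IsQuotientCoveringMap q₂ G₂)
    (hG₂ : Nat.card G₂ = p) (e₂ : E₂) (g₂ : G₂) (δ₂ : Path e₂ (g₂ • e₂))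
    (j₂ : Multiplicative ↥(𝔟.map (algebraMap (𝓞 k) (𝓞 K₀))) ≃* FundamentalGroup E₂ e₂)
    (hj₂ : ∀ b : ↥(𝔟.map (algebraMap (𝓞 k) (𝓞 K₀))),
      twistedTransport ⟨fun z ↦ g₂⁻¹ • z, continuous_const_smul _⟩ δ₂
        (inv_smul_smul g₂ e₂) (j₂ (ofAdd b)) = j₂ (ofAdd (hζ.toInteger • b))) :
    IsEmpty (FundamentalGroup X₁ (q₁ e₁) ≃* FundamentalGroup X₂ (q₂ e₂)) := by
  -- side 1
  set f₁ : C(E₁, X₁) := ⟨q₁, hq₁.isCoveringMap.continuous⟩ with hf₁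
  set ι₁ : FundamentalGroup E₁ e₁ →* FundamentalGroup X₁ (q₁ e₁) := FundamentalGroup.map f₁ e₁
    with hι₁
  have hιeq₁ : FundamentalGroup.mapOfEq f₁ (⟨e₁, rfl⟩ : q₁ ⁻¹' {q₁ e₁}).2 = ι₁ :=
    MonoidHom.ext (mapOfEq_rfl_apply f₁ e₁)
  have hinj₁ : Function.Injective ι₁ :=
    hιeq₁ ▸ mapOfEq_injective_of_isCoveringMap hq₁.isCoveringMap ⟨e₁, rfl⟩
  have hnorm₁ : ι₁.range.Normal := hιeq₁ ▸ QuotientCovering.normal_range_mapOfEq hq₁ ⟨e₁, rfl⟩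
  have hidx₁ : ι₁.range.index = p := by rw [← hιeq₁, QuotientCovering.index_range_mapOfEq hq₁ ⟨e₁, rfl⟩, hG₁]
  set ιN₁ : Multiplicative (𝓞 K₀) →* FundamentalGroup X₁ (q₁ e₁) := ι₁.comp j₁.toMonoidHom
    with hιN₁
  have hrange₁ : ιN₁.range = ι₁.range := by
    rw [hιN₁, MonoidHom.range_comp, MonoidHom.range_eq_top.2 j₁.surjective, ← MonoidHom.range_eq_map]
  have hinjN₁ : Function.Injective ιN₁ := hinj₁.comp j₁.injective
  haveI : ιN₁.range.Normal := hrange₁ ▸ hnorm₁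
  have hidxN₁ : ιN₁.range.index = p := by rw [hrange₁, hidx₁]
  have hT₁ : ∀ z, f₁ ((⟨fun z ↦ g₁⁻¹ • z, continuous_const_smul _⟩ : C(E₁, E₁)) z) = f₁ z :=
    fun z ↦ (hq₁.apply_eq_iff_mem_orbit).2 (MulAction.mem_orbit _ _)
  set γ₁ := baseLoop f₁ δ₁ (by rw [← hT₁ (g₁ • e₁)]; simp) with hγ₁
  have hconj₁ : ∀ s : 𝓞 K₀, γ₁ * ιN₁ (ofAdd s) * γ₁⁻¹ = ιN₁ (ofAdd (hζ.toInteger * s)) := by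
    intro s
    have := map_twistedTransport_eq_conj f₁ ⟨fun z ↦ g₁⁻¹ • z, continuous_const_smul _⟩ hT₁ δ₁
      (inv_smul_smul g₁ e₁) (j₁ (ofAdd s))
    rw [hj₁] at this
    exact this.symm
  -- side 2
  set f₂ : C(E₂, X₂) := ⟨q₂, hq₂.isCoveringMap.continuous⟩ with hf₂
  set ι₂ : FundamentalGroup E₂ e₂ →* FundamentalGroup X₂ (q₂ e₂) := FundamentalGroup.map f₂ e₂
    with hι₂
  have hιeq₂ : FundamentalGroup.mapOfEq f₂ (⟨e₂, rfl⟩ : q₂ ⁻¹' {q₂ e₂}).2 = ι₂ :=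
    MonoidHom.ext (mapOfEq_rfl_apply f₂ e₂)
  have hinj₂ : Function.Injective ι₂ :=
    hιeq₂ ▸ mapOfEq_injective_of_isCoveringMap hq₂.isCoveringMap ⟨e₂, rfl⟩
  have hnorm₂ : ι₂.range.Normal := hιeq₂ ▸ QuotientCovering.normal_range_mapOfEq hq₂ ⟨e₂, rfl⟩
  have hidx₂ : ι₂.range.index = p := by rw [← hιeq₂, QuotientCovering.index_range_mapOfEq hq₂ ⟨e₂, rfl⟩, hG₂]
  set ιN₂ : Multiplicative ↥(𝔟.map (algebraMap (𝓞 k) (𝓞 K₀))) →* FundamentalGroup X₂ (q₂ e₂) :=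
    ι₂.comp j₂.toMonoidHom with hιN₂
  have hrange₂ : ιN₂.range = ι₂.range := by
    rw [hιN₂, MonoidHom.range_comp, MonoidHom.range_eq_top.2 j₂.surjective, ← MonoidHom.range_eq_map]
  have hinjN₂ : Function.Injective ιN₂ := hinj₂.comp j₂.injective
  haveI : ιN₂.range.Normal := hrange₂ ▸ hnorm₂
  have hidxN₂ : ιN₂.range.index = p := by rw [hrange₂, hidx₂]
  have hT₂ : ∀ z, f₂ ((⟨fun z ↦ g₂⁻¹ • z, continuous_const_smul _⟩ : C(E₂, E₂)) z) = f₂ z :=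
    fun z ↦ (hq₂.apply_eq_iff_mem_orbit).2 (MulAction.mem_orbit _ _)
  set γ₂ := baseLoop f₂ δ₂ (by rw [← hT₂ (g₂ • e₂)]; simp) with hγ₂
  have hconj₂ : ∀ b : ↥(𝔟.map (algebraMap (𝓞 k) (𝓞 K₀))),
      γ₂ * ιN₂ (ofAdd b) * γ₂⁻¹ = ιN₂ (ofAdd (hζ.toInteger • b)) := by
    intro b
    have := map_twistedTransport_eq_conj f₂ ⟨fun z ↦ g₂⁻¹ • z, continuous_const_smul _⟩ hT₂ δ₂
      (inv_smul_smul g₂ e₂) (j₂ (ofAdd b))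
    rw [hj₂] at this
    exact this.symm
  exact isEmpty_mulEquiv_numberField hζ h𝔟0 h𝔟 hcop ιN₁ hinjN₁ hidxN₁ γ₁ hconj₁ ιN₂ hinjN₂
    hidxN₂ γ₂ hconj₂



/-- **Serre 1964 for topological models: the quotients are not homeomorphic.** Under the
hypotheses of `isEmpty_mulEquiv_fundamentalGroup_of_quotientCovering`, `X₁ = E₁/G₁` and
`X₂ = E₂/G₂` are not homeomorphic ("en particulier, `V_φ` et `V_ψ` ne sont pas homéomorphes"):
`X₂` is path connected (image of `E₂`), so a homeomorphism would give
`π₁(X₁, q₁ e₁) ≅ π₁(X₂, f(q₁ e₁)) ≅ π₁(X₂, q₂ e₂)`.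
[cite: Serre1964Conjugate, p. 4194 and Théorème p. 4196] -/
theorem isEmpty_homeomorph_of_quotientCovering
    {p : ℕ} [Fact p.Prime] {K₀ : Type*} [Field K₀] [NumberField K₀]
    [IsCyclotomicExtension {p} ℚ K₀] {ζ : K₀} (hζ : IsPrimitiveRoot ζ p)
    {k : Type*} [Field k] [NumberField k] [Algebra k K₀]
    {𝔟 : Ideal (𝓞 k)} (h𝔟0 : 𝔟 ≠ ⊥) (h𝔟 : ¬ 𝔟.IsPrincipal)
    (hcop : Nat.Coprime (Module.finrank k K₀) (Fintype.card (ClassGroup (𝓞 k))))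
    {E₁ X₁ G₁ : Type*} [TopologicalSpace E₁] [TopologicalSpace X₁] [Group G₁] [MulAction G₁ E₁]
    [ContinuousConstSMul G₁ E₁] [PathConnectedSpace E₁] {q₁ : E₁ → X₁}
    (hq₁ : IsQuotientCoveringMap q₁ G₁)
    (hG₁ : Nat.card G₁ = p) (e₁ : E₁) (g₁ : G₁) (δ₁ : Path e₁ (g₁ • e₁))
    (j₁ : Multiplicative (𝓞 K₀) ≃* FundamentalGroup E₁ e₁)
    (hj₁ : ∀ s : 𝓞 K₀, twistedTransport ⟨fun z ↦ g₁⁻¹ • z, continuous_const_smul _⟩ δ₁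
      (inv_smul_smul g₁ e₁) (j₁ (ofAdd s)) = j₁ (ofAdd (hζ.toInteger * s)))
    {E₂ X₂ G₂ : Type*} [TopologicalSpace E₂] [TopologicalSpace X₂] [Group G₂] [MulAction G₂ E₂]
    [ContinuousConstSMul G₂ E₂] [PathConnectedSpace E₂] {q₂ : E₂ → X₂}
    (hq₂ : IsQuotientCoveringMap q₂ G₂)
    (hG₂ : Nat.card G₂ = p) (e₂ : E₂) (g₂ : G₂) (δ₂ : Path e₂ (g₂ • e₂))
    (j₂ : Multiplicative ↥(𝔟.map (algebraMap (𝓞 k) (𝓞 K₀))) ≃* FundamentalGroup E₂ e₂)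
    (hj₂ : ∀ b : ↥(𝔟.map (algebraMap (𝓞 k) (𝓞 K₀))),
      twistedTransport ⟨fun z ↦ g₂⁻¹ • z, continuous_const_smul _⟩ δ₂
        (inv_smul_smul g₂ e₂) (j₂ (ofAdd b)) = j₂ (ofAdd (hζ.toInteger • b))) :
    IsEmpty (X₁ ≃ₜ X₂) := by
  haveI : PathConnectedSpace X₂ := hq₂.surjective.pathConnectedSpace hq₂.isCoveringMap.continuous
  refine ⟨fun f ↦ (isEmpty_mulEquiv_fundamentalGroup_of_quotientCovering hζ h𝔟0 h𝔟 hcop hq₁ hG₁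
    e₁ g₁ δ₁ j₁ hj₁ hq₂ hG₂ e₂ g₂ δ₂ j₂ hj₂).false ?_⟩
  exact (fundamentalGroupEquivOfHomeomorph f rfl).trans
    (FundamentalGroup.fundamentalGroupMulEquivOfPathConnected (f (q₁ e₁)) (q₂ e₂))


/-- **Serre 1964, no. 2 with the Théorème, in topological form.** Let `Yᵢ` be simply connected
and `Aᵢ` path connected with abelian `π₁(Aᵢ, aᵢ)` (`i = 1, 2`), let groups `Gᵢ` of prime order `p`
act on `Yᵢ` and `Aᵢ` so that the diagonal action on `Yᵢ × Aᵢ` has a quotient covering map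
`qᵢ : Yᵢ × Aᵢ → Xᵢ` ("`V` le quotient de `Y × A` par `G`", the action on `Y` being free), with
`gᵢ • aᵢ = aᵢ` (`G` acts on the abelian variety `A` by group automorphisms), and suppose
`π₁(A₁, a₁) ≅ (𝓞 K₀, +)`, `π₁(A₂, a₂) ≅ (𝔟 𝓞 K₀, +)` with `(gᵢ⁻¹)_*` acting as multiplication by
`ζ_p` ("les opérations de `G` sur `π₁(A_φ)` étant celles déduites de la structure de `S`-module";
`π₁(A_φ) ≅ S`, `π₁(A_ψ) ≅ e_ψ S`, Lemme 2), where `K₀ = ℚ(ζ_p) ⊇ k`, `𝔟 ⊂ 𝓞 k` is non-principal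
and `([K₀ : k], h_k) = 1`.  Then `X₁ = (Y₁ × A₁)/G₁` and `X₂ = (Y₂ × A₂)/G₂` are NOT homeomorphic.
Reduction to `isEmpty_homeomorph_of_quotientCovering`: `π₁(Yᵢ × Aᵢ) ≅ π₁(Aᵢ)` by the projection
(`bijective_map_snd_of_simplyConnectedSpace`), twisted transport is natural in the projection
(`map_twistedTransport_of_semiconj`) and on the abelian `π₁(Aᵢ, aᵢ)`, along the loop component
of `δᵢ`, it is just `(gᵢ⁻¹)_*` (`twistedTransport_eq_mapOfEq_of_comm'`).
[cite: Serre1964Conjugate, no. 2 (p. 4195) and Théorème p. 4196] -/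
theorem isEmpty_homeomorph_of_quotientCovering_prod
    {p : ℕ} [Fact p.Prime] {K₀ : Type*} [Field K₀] [NumberField K₀]
    [IsCyclotomicExtension {p} ℚ K₀] {ζ : K₀} (hζ : IsPrimitiveRoot ζ p)
    {k : Type*} [Field k] [NumberField k] [Algebra k K₀]
    {𝔟 : Ideal (𝓞 k)} (h𝔟0 : 𝔟 ≠ ⊥) (h𝔟 : ¬ 𝔟.IsPrincipal)
    (hcop : Nat.Coprime (Module.finrank k K₀) (Fintype.card (ClassGroup (𝓞 k))))
    {Y₁ A₁ X₁ G₁ : Type*} [TopologicalSpace Y₁] [TopologicalSpace A₁] [TopologicalSpace X₁]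
    [SimplyConnectedSpace Y₁] [PathConnectedSpace A₁] [Group G₁] [MulAction G₁ Y₁]
    [MulAction G₁ A₁] [ContinuousConstSMul G₁ Y₁] [ContinuousConstSMul G₁ A₁]
    {q₁ : Y₁ × A₁ → X₁} (hq₁ : IsQuotientCoveringMap q₁ G₁) (hG₁ : Nat.card G₁ = p)
    (y₁ : Y₁) (a₁ : A₁) (g₁ : G₁) (hg₁ : g₁ • a₁ = a₁)
    (hcomm₁ : ∀ u v : FundamentalGroup A₁ a₁, u * v = v * u)
    (j₁ : Multiplicative (𝓞 K₀) ≃* FundamentalGroup A₁ a₁)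
    (hj₁ : ∀ s : 𝓞 K₀, FundamentalGroup.mapOfEq (⟨fun a ↦ g₁⁻¹ • a, continuous_const_smul _⟩ :
      C(A₁, A₁)) (inv_smul_eq_iff.2 hg₁.symm) (j₁ (ofAdd s)) = j₁ (ofAdd (hζ.toInteger * s)))
    {Y₂ A₂ X₂ G₂ : Type*} [TopologicalSpace Y₂] [TopologicalSpace A₂] [TopologicalSpace X₂]
    [SimplyConnectedSpace Y₂] [PathConnectedSpace A₂] [Group G₂] [MulAction G₂ Y₂]
    [MulAction G₂ A₂] [ContinuousConstSMul G₂ Y₂] [ContinuousConstSMul G₂ A₂]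
    {q₂ : Y₂ × A₂ → X₂} (hq₂ : IsQuotientCoveringMap q₂ G₂) (hG₂ : Nat.card G₂ = p)
    (y₂ : Y₂) (a₂ : A₂) (g₂ : G₂) (hg₂ : g₂ • a₂ = a₂)
    (hcomm₂ : ∀ u v : FundamentalGroup A₂ a₂, u * v = v * u)
    (j₂ : Multiplicative ↥(𝔟.map (algebraMap (𝓞 k) (𝓞 K₀))) ≃* FundamentalGroup A₂ a₂)
    (hj₂ : ∀ b : ↥(𝔟.map (algebraMap (𝓞 k) (𝓞 K₀))),
      FundamentalGroup.mapOfEq (⟨fun a ↦ g₂⁻¹ • a, continuous_const_smul _⟩ : C(A₂, A₂))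
        (inv_smul_eq_iff.2 hg₂.symm) (j₂ (ofAdd b)) = j₂ (ofAdd (hζ.toInteger • b))) :
    IsEmpty (X₁ ≃ₜ X₂) := by
  -- model 1: transfer the data from `A₁` to `Y₁ × A₁`
  let snd₁ : C(Y₁ × A₁, A₁) := ⟨Prod.snd, continuous_snd⟩
  let σ₁ : FundamentalGroup (Y₁ × A₁) (y₁, a₁) ≃* FundamentalGroup A₁ a₁ :=
    MulEquiv.ofBijective (FundamentalGroup.map snd₁ (y₁, a₁))
      (bijective_map_snd_of_simplyConnectedSpace y₁ a₁)
  let J₁ : Multiplicative (𝓞 K₀) ≃* FundamentalGroup (Y₁ × A₁) (y₁, a₁) := j₁.trans σ₁.symm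
  let δ₁ : Path (y₁, a₁) (g₁ • (y₁, a₁)) :=
    (PathConnectedSpace.somePath y₁ (g₁ • y₁)).prod ((Path.refl a₁).cast rfl hg₁)
  have hJ₁ : ∀ s : 𝓞 K₀, twistedTransport ⟨fun z ↦ g₁⁻¹ • z, continuous_const_smul _⟩ δ₁
      (inv_smul_smul g₁ (y₁, a₁)) (J₁ (ofAdd s)) = J₁ (ofAdd (hζ.toInteger * s)) := by
    intro s
    apply (bijective_map_snd_of_simplyConnectedSpace (Y := Y₁) y₁ a₁).1
    have hnat := map_twistedTransport_of_semiconj snd₁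
      (⟨fun z ↦ g₁⁻¹ • z, continuous_const_smul _⟩ : C(Y₁ × A₁, Y₁ × A₁))
      (⟨fun a ↦ g₁⁻¹ • a, continuous_const_smul _⟩ : C(A₁, A₁)) (fun _ ↦ rfl) δ₁
      (inv_smul_smul g₁ (y₁, a₁)) (J₁ (ofAdd s))
    rw [hnat]
    have hσJ : ∀ x, FundamentalGroup.map snd₁ (y₁, a₁) (J₁ x) = j₁ x := fun x ↦
      σ₁.apply_symm_apply (j₁ x)
    rw [hσJ, hσJ, twistedTransport_eq_mapOfEq_of_comm' _ _ hg₁ _ (inv_smul_eq_iff.2 hg₁.symm)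
      hcomm₁, hj₁]
  -- model 2
  let snd₂ : C(Y₂ × A₂, A₂) := ⟨Prod.snd, continuous_snd⟩
  let σ₂ : FundamentalGroup (Y₂ × A₂) (y₂, a₂) ≃* FundamentalGroup A₂ a₂ :=
    MulEquiv.ofBijective (FundamentalGroup.map snd₂ (y₂, a₂))
      (bijective_map_snd_of_simplyConnectedSpace y₂ a₂)
  let J₂ : Multiplicative ↥(𝔟.map (algebraMap (𝓞 k) (𝓞 K₀))) ≃*
      FundamentalGroup (Y₂ × A₂) (y₂, a₂) := j₂.trans σ₂.symm
  let δ₂ : Path (y₂, a₂) (g₂ • (y₂, a₂)) :=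
    (PathConnectedSpace.somePath y₂ (g₂ • y₂)).prod ((Path.refl a₂).cast rfl hg₂)
  have hJ₂ : ∀ b : ↥(𝔟.map (algebraMap (𝓞 k) (𝓞 K₀))),
      twistedTransport ⟨fun z ↦ g₂⁻¹ • z, continuous_const_smul _⟩ δ₂
        (inv_smul_smul g₂ (y₂, a₂)) (J₂ (ofAdd b)) = J₂ (ofAdd (hζ.toInteger • b)) := by
    intro b
    apply (bijective_map_snd_of_simplyConnectedSpace (Y := Y₂) y₂ a₂).1
    have hnat := map_twistedTransport_of_semiconj snd₂
      (⟨fun z ↦ g₂⁻¹ • z, continuous_const_smul _⟩ : C(Y₂ × A₂, Y₂ × A₂))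
      (⟨fun a ↦ g₂⁻¹ • a, continuous_const_smul _⟩ : C(A₂, A₂)) (fun _ ↦ rfl) δ₂
      (inv_smul_smul g₂ (y₂, a₂)) (J₂ (ofAdd b))
    rw [hnat]
    have hσJ : ∀ x, FundamentalGroup.map snd₂ (y₂, a₂) (J₂ x) = j₂ x := fun x ↦
      σ₂.apply_symm_apply (j₂ x)
    rw [hσJ, hσJ, twistedTransport_eq_mapOfEq_of_comm' _ _ hg₂ _ (inv_smul_eq_iff.2 hg₂.symm)
      hcomm₂, hj₂]
  exact isEmpty_homeomorph_of_quotientCovering hζ h𝔟0 h𝔟 hcop hq₁ hG₁ (y₁, a₁) g₁ δ₁ J₁ hJ₁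
    hq₂ hG₂ (y₂, a₂) g₂ δ₂ J₂ hJ₂


/-- **Serre 1964 for torus models (no. 2 with the Théorème; all topological hypotheses on `A`
discharged).** Let `Aᵢ = Vᵢ/Λᵢ` be tori (`Vᵢ` simply connected commutative topological groups,
`Λᵢ` discrete subgroups) with `Λ₁ ≅ 𝓞 K₀` and `Λ₂ ≅ 𝔟 𝓞 K₀` additively, so that multiplication
by `ζ_p` becomes the restriction of continuous additive maps `Mᵢ : Vᵢ → Vᵢ` ("`S` opère sur `A`":
`Aᵢ(ℂ) = ℂ^g/π₁(Aᵢ)`, `π₁(A_φ) ≅ S`, `π₁(A_ψ) ≅ e_ψ S`); let groups `Gᵢ` of prime order `p` act on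
simply connected `Yᵢ` and on `Aᵢ`, an element `gᵢ⁻¹` acting on `Aᵢ` as the torus map of `Mᵢ`, with
quotient covering maps `qᵢ : Yᵢ × Aᵢ → Xᵢ` for the diagonal actions; `K₀ = ℚ(ζ_p) ⊇ k`,
`𝔟 ⊂ 𝓞 k` non-principal, `([K₀ : k], h_k) = 1`.  Then `X₁ ≄ₜ X₂`
(`exists_mulEquiv_fundamentalGroup_torus` feeds `isEmpty_homeomorph_of_quotientCovering_prod`).
[cite: Serre1964Conjugate, nos. 1–2 and Théorème p. 4196] -/
theorem isEmpty_homeomorph_of_torusModels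
    {p : ℕ} [Fact p.Prime] {K₀ : Type*} [Field K₀] [NumberField K₀]
    [IsCyclotomicExtension {p} ℚ K₀] {ζ : K₀} (hζ : IsPrimitiveRoot ζ p)
    {k : Type*} [Field k] [NumberField k] [Algebra k K₀]
    {𝔟 : Ideal (𝓞 k)} (h𝔟0 : 𝔟 ≠ ⊥) (h𝔟 : ¬ 𝔟.IsPrincipal)
    (hcop : Nat.Coprime (Module.finrank k K₀) (Fintype.card (ClassGroup (𝓞 k))))
    -- model 1
    {Y₁ V₁ X₁ G₁ : Type*} [TopologicalSpace Y₁] [SimplyConnectedSpace Y₁] [AddCommGroup V₁]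
    [TopologicalSpace V₁] [IsTopologicalAddGroup V₁] [SimplyConnectedSpace V₁]
    [TopologicalSpace X₁] (Λ₁ : AddSubgroup V₁) (hΛ₁ : IsDiscrete (Λ₁ : Set V₁))
    (M₁ : V₁ →+ V₁) (hM₁c : Continuous M₁) (hM₁ : ∀ v ∈ Λ₁, M₁ v ∈ Λ₁)
    (ε₁ : 𝓞 K₀ ≃+ Λ₁) (hε₁ : ∀ s : 𝓞 K₀, ((ε₁ (hζ.toInteger * s) : Λ₁) : V₁) = M₁ (ε₁ s))
    [Group G₁] [MulAction G₁ Y₁] [MulAction G₁ (V₁ ⧸ Λ₁)] [ContinuousConstSMul G₁ Y₁]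
    [ContinuousConstSMul G₁ (V₁ ⧸ Λ₁)] {q₁ : Y₁ × (V₁ ⧸ Λ₁) → X₁}
    (hq₁ : IsQuotientCoveringMap q₁ G₁) (hG₁ : Nat.card G₁ = p) (g₁ : G₁)
    (hg₁ : ∀ a : V₁ ⧸ Λ₁, g₁⁻¹ • a = torusMap Λ₁ M₁ hM₁c hM₁ a)
    -- model 2
    {Y₂ V₂ X₂ G₂ : Type*} [TopologicalSpace Y₂] [SimplyConnectedSpace Y₂] [AddCommGroup V₂]
    [TopologicalSpace V₂] [IsTopologicalAddGroup V₂] [SimplyConnectedSpace V₂]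
    [TopologicalSpace X₂] (Λ₂ : AddSubgroup V₂) (hΛ₂ : IsDiscrete (Λ₂ : Set V₂))
    (M₂ : V₂ →+ V₂) (hM₂c : Continuous M₂) (hM₂ : ∀ v ∈ Λ₂, M₂ v ∈ Λ₂)
    (ε₂ : ↥(𝔟.map (algebraMap (𝓞 k) (𝓞 K₀))) ≃+ Λ₂)
    (hε₂ : ∀ b : ↥(𝔟.map (algebraMap (𝓞 k) (𝓞 K₀))),
      ((ε₂ (hζ.toInteger • b) : Λ₂) : V₂) = M₂ (ε₂ b))
    [Group G₂] [MulAction G₂ Y₂] [MulAction G₂ (V₂ ⧸ Λ₂)] [ContinuousConstSMul G₂ Y₂]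
    [ContinuousConstSMul G₂ (V₂ ⧸ Λ₂)] {q₂ : Y₂ × (V₂ ⧸ Λ₂) → X₂}
    (hq₂ : IsQuotientCoveringMap q₂ G₂) (hG₂ : Nat.card G₂ = p) (g₂ : G₂)
    (hg₂ : ∀ a : V₂ ⧸ Λ₂, g₂⁻¹ • a = torusMap Λ₂ M₂ hM₂c hM₂ a) :
    IsEmpty (X₁ ≃ₜ X₂) := by
  obtain ⟨j₁, hj₁, hcomm₁⟩ := exists_mulEquiv_fundamentalGroup_torus Λ₁ hΛ₁ M₁ hM₁c hM₁
    (fun s ↦ hζ.toInteger * s) ε₁ hε₁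
  obtain ⟨j₂, hj₂, hcomm₂⟩ := exists_mulEquiv_fundamentalGroup_torus Λ₂ hΛ₂ M₂ hM₂c hM₂
    (fun b ↦ hζ.toInteger • b) ε₂ hε₂
  have hfix₁ : g₁ • ((0 : V₁) : V₁ ⧸ Λ₁) = ((0 : V₁) : V₁ ⧸ Λ₁) := by
    have h := hg₁ ((0 : V₁) : V₁ ⧸ Λ₁)
    rw [torusMap_mk, map_zero] at h
    conv_lhs => rw [← h]
    exact smul_inv_smul g₁ _
  have hfix₂ : g₂ • ((0 : V₂) : V₂ ⧸ Λ₂) = ((0 : V₂) : V₂ ⧸ Λ₂) := by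
    have h := hg₂ ((0 : V₂) : V₂ ⧸ Λ₂)
    rw [torusMap_mk, map_zero] at h
    conv_lhs => rw [← h]
    exact smul_inv_smul g₂ _
  have hmap₁ : (⟨fun a ↦ g₁⁻¹ • a, continuous_const_smul _⟩ : C(V₁ ⧸ Λ₁, V₁ ⧸ Λ₁)) =
      torusMap Λ₁ M₁ hM₁c hM₁ := ContinuousMap.ext hg₁
  have hmap₂ : (⟨fun a ↦ g₂⁻¹ • a, continuous_const_smul _⟩ : C(V₂ ⧸ Λ₂, V₂ ⧸ Λ₂)) =
      torusMap Λ₂ M₂ hM₂c hM₂ := ContinuousMap.ext hg₂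
  haveI : PathConnectedSpace (V₁ ⧸ Λ₁) :=
    (QuotientAddGroup.mk_surjective (s := Λ₁)).pathConnectedSpace QuotientAddGroup.continuous_mk
  haveI : PathConnectedSpace (V₂ ⧸ Λ₂) :=
    (QuotientAddGroup.mk_surjective (s := Λ₂)).pathConnectedSpace QuotientAddGroup.continuous_mk
  refine isEmpty_homeomorph_of_quotientCovering_prod hζ h𝔟0 h𝔟 hcop hq₁ hG₁ (Classical.arbitrary Y₁)
    ((0 : V₁) : V₁ ⧸ Λ₁) g₁ hfix₁ hcomm₁ j₁ (fun s ↦ ?_) hq₂ hG₂ (Classical.arbitrary Y₂)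
    ((0 : V₂) : V₂ ⧸ Λ₂) g₂ hfix₂ hcomm₂ j₂ (fun b ↦ ?_)
  · rw [mapOfEq_congr_map hmap₁ _ (by rw [torusMap_mk, map_zero]) (j₁ (ofAdd s)), hj₁]
  · rw [mapOfEq_congr_map hmap₂ _ (by rw [torusMap_mk, map_zero]) (j₂ (ofAdd b)), hj₂]


/-- **Serre 1964 for torus models, orbit-space form.** As `isEmpty_homeomorph_of_torusModels`, with
the quotient covering property discharged: for FINITE groups `Gᵢ` of prime order `p` acting
freely and continuously on the locally compact Hausdorff spaces `Yᵢ × Vᵢ/Λᵢ`, the orbit spaces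
`(Y₁ × V₁/Λ₁)/G₁` and `(Y₂ × V₂/Λ₂)/G₂` (quotient topology) are not homeomorphic — Mathlib's
`isQuotientCoveringMap_quotientMk_of_properlyDiscontinuousSMul` (a free action of a finite group
on a locally compact Hausdorff space is a covering space action, Hatcher, §1.3, p. 72).  This is
the literal shape of "`V` le quotient de `Y × A` par `G`" for the complex points.
[cite: Serre1964Conjugate, no. 2 (p. 4195) and Théorème p. 4196]
[cite: HatcherAT2002, Prop. 1.40] -/
theorem isEmpty_homeomorph_orbitSpace_of_torusModels
    {p : ℕ} [Fact p.Prime] {K₀ : Type*} [Field K₀] [NumberField K₀]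
    [IsCyclotomicExtension {p} ℚ K₀] {ζ : K₀} (hζ : IsPrimitiveRoot ζ p)
    {k : Type*} [Field k] [NumberField k] [Algebra k K₀]
    {𝔟 : Ideal (𝓞 k)} (h𝔟0 : 𝔟 ≠ ⊥) (h𝔟 : ¬ 𝔟.IsPrincipal)
    (hcop : Nat.Coprime (Module.finrank k K₀) (Fintype.card (ClassGroup (𝓞 k))))
    -- model 1
    {Y₁ V₁ G₁ : Type*} [TopologicalSpace Y₁] [SimplyConnectedSpace Y₁] [LocallyCompactSpace Y₁]
    [T2Space Y₁] [AddCommGroup V₁] [TopologicalSpace V₁] [IsTopologicalAddGroup V₁]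
    [SimplyConnectedSpace V₁] (Λ₁ : AddSubgroup V₁) (hΛ₁ : IsDiscrete (Λ₁ : Set V₁))
    [LocallyCompactSpace (V₁ ⧸ Λ₁)] [T2Space (V₁ ⧸ Λ₁)]
    (M₁ : V₁ →+ V₁) (hM₁c : Continuous M₁) (hM₁ : ∀ v ∈ Λ₁, M₁ v ∈ Λ₁)
    (ε₁ : 𝓞 K₀ ≃+ Λ₁) (hε₁ : ∀ s : 𝓞 K₀, ((ε₁ (hζ.toInteger * s) : Λ₁) : V₁) = M₁ (ε₁ s))
    [Group G₁] [Finite G₁] [MulAction G₁ Y₁] [MulAction G₁ (V₁ ⧸ Λ₁)] [ContinuousConstSMul G₁ Y₁]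
    [ContinuousConstSMul G₁ (V₁ ⧸ Λ₁)] (hG₁ : Nat.card G₁ = p)
    (hfree₁ : ∀ (g : G₁) (z : Y₁ × (V₁ ⧸ Λ₁)), g • z = z → g = 1) (g₁ : G₁)
    (hg₁ : ∀ a : V₁ ⧸ Λ₁, g₁⁻¹ • a = torusMap Λ₁ M₁ hM₁c hM₁ a)
    -- model 2
    {Y₂ V₂ G₂ : Type*} [TopologicalSpace Y₂] [SimplyConnectedSpace Y₂] [LocallyCompactSpace Y₂]
    [T2Space Y₂] [AddCommGroup V₂] [TopologicalSpace V₂] [IsTopologicalAddGroup V₂]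
    [SimplyConnectedSpace V₂] (Λ₂ : AddSubgroup V₂) (hΛ₂ : IsDiscrete (Λ₂ : Set V₂))
    [LocallyCompactSpace (V₂ ⧸ Λ₂)] [T2Space (V₂ ⧸ Λ₂)]
    (M₂ : V₂ →+ V₂) (hM₂c : Continuous M₂) (hM₂ : ∀ v ∈ Λ₂, M₂ v ∈ Λ₂)
    (ε₂ : ↥(𝔟.map (algebraMap (𝓞 k) (𝓞 K₀))) ≃+ Λ₂)
    (hε₂ : ∀ b : ↥(𝔟.map (algebraMap (𝓞 k) (𝓞 K₀))),
      ((ε₂ (hζ.toInteger • b) : Λ₂) : V₂) = M₂ (ε₂ b))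
    [Group G₂] [Finite G₂] [MulAction G₂ Y₂] [MulAction G₂ (V₂ ⧸ Λ₂)] [ContinuousConstSMul G₂ Y₂]
    [ContinuousConstSMul G₂ (V₂ ⧸ Λ₂)] (hG₂ : Nat.card G₂ = p)
    (hfree₂ : ∀ (g : G₂) (z : Y₂ × (V₂ ⧸ Λ₂)), g • z = z → g = 1) (g₂ : G₂)
    (hg₂ : ∀ a : V₂ ⧸ Λ₂, g₂⁻¹ • a = torusMap Λ₂ M₂ hM₂c hM₂ a) :
    IsEmpty (MulAction.orbitRel.Quotient G₁ (Y₁ × (V₁ ⧸ Λ₁)) ≃ₜ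
      MulAction.orbitRel.Quotient G₂ (Y₂ × (V₂ ⧸ Λ₂))) := by
  haveI : IsCancelSMul G₁ (Y₁ × (V₁ ⧸ Λ₁)) := isCancelSMul_iff_eq_one_of_smul_eq.2 hfree₁
  haveI : IsCancelSMul G₂ (Y₂ × (V₂ ⧸ Λ₂)) := isCancelSMul_iff_eq_one_of_smul_eq.2 hfree₂
  exact isEmpty_homeomorph_of_torusModels hζ h𝔟0 h𝔟 hcop Λ₁ hΛ₁ M₁ hM₁c hM₁ ε₁ hε₁
    (isQuotientCoveringMap_quotientMk_of_properlyDiscontinuousSMul (G := G₁)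
      (E := Y₁ × (V₁ ⧸ Λ₁))) hG₁ g₁ hg₁ Λ₂ hΛ₂ M₂ hM₂c hM₂ ε₂ hε₂
    (isQuotientCoveringMap_quotientMk_of_properlyDiscontinuousSMul (G := G₂)
      (E := Y₂ × (V₂ ⧸ Λ₂))) hG₂ g₂ hg₂


/-- **Serre 1964 for lattice models** (the idiomatic form of `isEmpty_homeomorph_orbitSpace_of_torusModels`
for `A_φ(ℂ) = ℂ^g/Λ_φ`): `Vᵢ` finite-dimensional real normed spaces, `Lᵢ ⊂ Vᵢ` discrete additive
subgroups with `L₁ ≅ 𝓞 ℚ(ζ_p)`, `L₂ ≅ 𝔟 𝓞 ℚ(ζ_p)` additively, `Mᵢ` real-linear maps preserving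
`Lᵢ` and restricting there to multiplication by `ζ_p`, finite groups of order `p` acting freely
on `Yᵢ × Vᵢ/Lᵢ` (`Yᵢ` simply connected, locally compact, Hausdorff) with a generator acting on
the torus through `Mᵢ`: the orbit spaces are not homeomorphic.
[cite: Serre1964Conjugate, nos. 1–2 and Théorème p. 4196] -/
theorem isEmpty_homeomorph_orbitSpace_of_latticeModels
    {p : ℕ} [Fact p.Prime] {K₀ : Type*} [Field K₀] [NumberField K₀]
    [IsCyclotomicExtension {p} ℚ K₀] {ζ : K₀} (hζ : IsPrimitiveRoot ζ p)
    {k : Type*} [Field k] [NumberField k] [Algebra k K₀]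
    {𝔟 : Ideal (𝓞 k)} (h𝔟0 : 𝔟 ≠ ⊥) (h𝔟 : ¬ 𝔟.IsPrincipal)
    (hcop : Nat.Coprime (Module.finrank k K₀) (Fintype.card (ClassGroup (𝓞 k))))
    -- model 1
    {Y₁ V₁ G₁ : Type*} [TopologicalSpace Y₁] [SimplyConnectedSpace Y₁] [LocallyCompactSpace Y₁]
    [T2Space Y₁] [NormedAddCommGroup V₁] [NormedSpace ℝ V₁] [FiniteDimensional ℝ V₁]
    (L₁ : Submodule ℤ V₁) [DiscreteTopology L₁] (M₁ : V₁ →ₗ[ℝ] V₁) (hM₁ : ∀ v ∈ L₁, M₁ v ∈ L₁)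
    (ε₁ : 𝓞 K₀ ≃+ L₁.toAddSubgroup)
    (hε₁ : ∀ s : 𝓞 K₀, ((ε₁ (hζ.toInteger * s) : L₁.toAddSubgroup) : V₁) = M₁ (ε₁ s))
    [Group G₁] [Finite G₁] [MulAction G₁ Y₁] [MulAction G₁ (V₁ ⧸ L₁.toAddSubgroup)]
    [ContinuousConstSMul G₁ Y₁] [ContinuousConstSMul G₁ (V₁ ⧸ L₁.toAddSubgroup)]
    (hG₁ : Nat.card G₁ = p)
    (hfree₁ : ∀ (g : G₁) (z : Y₁ × (V₁ ⧸ L₁.toAddSubgroup)), g • z = z → g = 1) (g₁ : G₁)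
    (hg₁ : ∀ a : V₁ ⧸ L₁.toAddSubgroup, g₁⁻¹ • a = torusMap L₁.toAddSubgroup M₁.toAddMonoidHom
      M₁.continuous_of_finiteDimensional hM₁ a)
    -- model 2
    {Y₂ V₂ G₂ : Type*} [TopologicalSpace Y₂] [SimplyConnectedSpace Y₂] [LocallyCompactSpace Y₂]
    [T2Space Y₂] [NormedAddCommGroup V₂] [NormedSpace ℝ V₂] [FiniteDimensional ℝ V₂]
    (L₂ : Submodule ℤ V₂) [DiscreteTopology L₂] (M₂ : V₂ →ₗ[ℝ] V₂) (hM₂ : ∀ v ∈ L₂, M₂ v ∈ L₂)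
    (ε₂ : ↥(𝔟.map (algebraMap (𝓞 k) (𝓞 K₀))) ≃+ L₂.toAddSubgroup)
    (hε₂ : ∀ b : ↥(𝔟.map (algebraMap (𝓞 k) (𝓞 K₀))),
      ((ε₂ (hζ.toInteger • b) : L₂.toAddSubgroup) : V₂) = M₂ (ε₂ b))
    [Group G₂] [Finite G₂] [MulAction G₂ Y₂] [MulAction G₂ (V₂ ⧸ L₂.toAddSubgroup)]
    [ContinuousConstSMul G₂ Y₂] [ContinuousConstSMul G₂ (V₂ ⧸ L₂.toAddSubgroup)]
    (hG₂ : Nat.card G₂ = p)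
    (hfree₂ : ∀ (g : G₂) (z : Y₂ × (V₂ ⧸ L₂.toAddSubgroup)), g • z = z → g = 1) (g₂ : G₂)
    (hg₂ : ∀ a : V₂ ⧸ L₂.toAddSubgroup, g₂⁻¹ • a = torusMap L₂.toAddSubgroup M₂.toAddMonoidHom
      M₂.continuous_of_finiteDimensional hM₂ a) :
    IsEmpty (MulAction.orbitRel.Quotient G₁ (Y₁ × (V₁ ⧸ L₁.toAddSubgroup)) ≃ₜ
      MulAction.orbitRel.Quotient G₂ (Y₂ × (V₂ ⧸ L₂.toAddSubgroup))) :=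
  isEmpty_homeomorph_orbitSpace_of_torusModels hζ h𝔟0 h𝔟 hcop L₁.toAddSubgroup
    DiscreteTopology.isDiscrete M₁.toAddMonoidHom M₁.continuous_of_finiteDimensional hM₁ ε₁ hε₁
    hG₁ hfree₁ g₁ hg₁ L₂.toAddSubgroup DiscreteTopology.isDiscrete M₂.toAddMonoidHom
    M₂.continuous_of_finiteDimensional hM₂ ε₂ hε₂ hG₂ hfree₂ g₂ hg₂

end Literature.Barriers.HodgeConjecture.Serre1964

end
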